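import Mathlib
import HarnessLib.Audit
import Summits.PneNP.PneNP.Theorems.PstarSwitchSplit

/-!
# No centre on the gated side of a switch-coupled split (ROUND-24, O1; all core sizes; memo g25 §42.5)

FRONTIER range-avoidance ladder, rung F-N3, ROUND 24 (cell `pnp-ideate`, prover-2 memo `g25/O1-XORSPLIT-g25.md` §42; typed targets
`PstarCoreBoundTargets.TerminalFive` / `TerminalPeelable` (p646951); restricted-model proof complexity — nothing here bears on `P` versus `NP`).

`PstarSwitchSplit.no_centre_of_switch` needs the straddling monomials to be a single AND pair.  This file records the ONE-SIDED version: inside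
the core-bound induction, if every reader monomial straddling a variable cut `P` (all variables of `A` inside, none of `B`) gates to ONE variable
`q` outside `P` — any number of gated literals on the `A`-side — then the side `A` carries no non-empty leafless set of non-chords of `K`
(**`no_centre_side_of_switch`**): `A` is itself terminal (`exists_terminal_side`), its members share no variable with `B` so non-chords of `K`
inside `A` are non-chords of `A`, and a centre forces `12 ≤ 2·#sharedSlots A ≤ #A` (`twelve_le_two_mul_card_sharedSlots`) against `#A ≤ 5`.
-/

set_option linter.dupNamespace false -- `Summit.PneNP.PneNP.…`: summit = sub-problem name (D-0017 single-conjunct layout)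

open Finset Literature.Computability.Complexity
open Summit.PneNP.PneNP.Theorems.PstarTyped (Typed)
open Summit.PneNP.PneNP.Theorems.PstarSALevel (varSet bdry BoundaryExpanding SimpleOverlap)
open Summit.PneNP.PneNP.Theorems.PstarSAClosure (degIn mem_bdry_iff)
open Summit.PneNP.PneNP.Theorems.PstarXCore (xverts)
open Summit.PneNP.PneNP.Theorems.PstarChordRepair (IsChord)
open Summit.PneNP.PneNP.Theorems.PstarCoreBoundTargets (Terminal)
open Summit.PneNP.PneNP.Theorems.PstarSharingBound (two_mul_card_sharedSlots_le)
open Summit.PneNP.PneNP.Theorems.PstarChordBridgeTools (xpdeg)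
open Summit.PneNP.PneNP.Theorems.PstarTerminalPeelableTwelve (twelve_le_two_mul_card_sharedSlots)
open Summit.PneNP.PneNP.Theorems.PstarSwitchSplit (exists_terminal_side)

namespace Summit.PneNP.PneNP.Theorems.PstarSwitchSplitCentre

variable {n m : ℕ} {I : LocalMap 4 n m} {r : ℕ} {y : Fin m → Bool} {K : Finset (Fin m)} {w₁ w₂ : Finset (Fin n) × Finset (Fin m) × Bool}

/-- **NO CENTRE ON THE GATED SIDE** (inside the induction; one-sided hypothesis).  If every reader monomial straddling the cut gates to ONE
outside variable `q` and the gated side `A` carries a non-empty leafless set of non-chords of `K`, contradiction: `A` is a terminal core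
(`exists_terminal_side`) with a centre (its members share no variable with `B`, so non-chords of `K` in `A` are non-chords of `A`), hence
`12 ≤ 2·#sharedSlots A ≤ #A`, against `#A ≤ 5`.  No hypothesis on the monomials' `P`-endpoints. -/
theorem no_centre_side_of_switch (hI : I.IsPure xorAndPred) (hT : Typed I) (hS : SimpleOverlap I) (hB : BoundaryExpanding r I)
    (ht : Terminal I r y K w₁ w₂) {A B : Finset (Fin m)} (hAB : A ∪ B = K) (hBn : B.Nonempty)
    (P : Finset (Fin n)) (hAP : ∀ j ∈ A, ∀ s : Fin 4, I.vars j s ∈ P) (hBP : ∀ j ∈ B, ∀ s : Fin 4, I.vars j s ∉ P)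
    {q : Fin n} (hq : q ∉ P)
    (hsw : ∀ g ∈ w₁.2.1 ∪ w₂.2.1, (I.vars g 2 ∈ P ↔ I.vars g 3 ∈ P) ∨ (I.vars g 2 ∈ P ∧ I.vars g 3 = q) ∨ (I.vars g 3 ∈ P ∧ I.vars g 2 = q))
    (hIH : ∀ c ∈ K, ∀ K₀ ⊆ K.erase c, ∀ d₁ d₂ : Finset (Fin n) × Finset (Fin m) × Bool, Terminal I r y K₀ d₁ d₂ → K₀.card ≤ 5)
    {S : Finset (Fin m)} (hSA : S ⊆ A) (hne : S.Nonempty) (hL : ∀ w ∈ xverts I S, 2 ≤ xpdeg I S w) (hnc : ∀ f ∈ S, ¬ IsChord I K f) :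
    False := by
  classical
  have hAK : A ⊆ K := by rw [← hAB]; exact subset_union_left
  have hBK : B ⊆ K := by rw [← hAB]; exact subset_union_right
  have hAB' : ∀ j ∈ A, j ∉ B := fun j hjA hjB => hBP j hjB 0 (hAP j hjA 0)
  obtain ⟨b₀, hb₀⟩ := hBn
  obtain ⟨d₁, d₂, -, -, -, -, htA⟩ := exists_terminal_side hI hT hS hB ht hAB (hne.mono hSA) ⟨b₀, hb₀⟩ P hAP hBP hq hsw
  have hA5 : A.card ≤ 5 :=
    hIH b₀ (hBK hb₀) A (fun j hj => mem_erase.2 ⟨fun h => hAB' j hj (h ▸ hb₀), hAK hj⟩) d₁ d₂ htA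
  -- non-chords of `K` inside `A` are non-chords of `A`: their shared AND variable is read by another member of `K`, necessarily in `A`
  have hncA : ∀ f ∈ S, ¬ IsChord I A f := by
    intro f hf hchA
    apply hnc f hf
    have key : ∀ s : Fin 4, I.vars f s ∈ bdry I A → I.vars f s ∈ bdry I K := by
      intro s hs
      rw [mem_bdry_iff] at hs ⊢
      unfold PstarSAClosure.degIn at hs ⊢
      rw [← hs, ← hAB, filter_union]
      have hB0 : (B.filter fun j => I.vars f s ∈ varSet I j) = ∅ := by
        refine filter_eq_empty_iff.2 fun j hj hv => ?_
        unfold PstarSALevel.varSet at hv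
        obtain ⟨s', -, hs'⟩ := mem_image.1 hv
        exact hBP j hj s' (hs' ▸ hAP f (hSA hf) s)
      rw [hB0, union_empty]
    exact ⟨key 2 hchA.1, key 3 hchA.2⟩
  have h12 := twelve_le_two_mul_card_sharedSlots I hI hT hS hB htA.2.2.1.le hSA hne hL hncA
  have h2 := two_mul_card_sharedSlots_le I A htA.2.1 (hB A htA.2.2.1.le)
  omega

end Summit.PneNP.PneNP.Theorems.PstarSwitchSplitCentre
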